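import Summits.Parity.BatemanHorn.Theses.RoughValueTransport
import Summits.Parity.BatemanHorn.Theorems.RoughValueTransportRoughValueLawOfRatioLaws
import Literature.NumberTheory.Sieve.BuchstabLimitFact
import HarnessLib

/-!
# Route `RoughValueTransport`, crux `RoughValueLaw` (stmt-Parity-11390), line
# `omega-class-shape-split`: the registered stub `stub_amplitudeAnchor`

`--supports` file of the checked skeleton
`Summits/Parity/BatemanHorn/Cruxes/RoughValueLaw/Lines/omega-class-shape-split.lean`
(crux `Summit.Parity.BatemanHorn.Theses.RoughValueTransport.RoughValueLaw`).  It PROVES the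
registered stub `stub_amplitudeAnchor` verbatim — the rate-free ANCHORING service of the line:
for a Bateman–Horn system `f = (f₁,…,f_k)` write
`Φ_f(x,u) = #{1 ≤ n ≤ x : ∀ i, fᵢ(n) > 0 ∧ no prime p < ⌈x^{deg fᵢ/u}⌉ divides fᵢ(n)}` for the
jointly-rough count of the crux.  If a function `B₀ : ℕ → ℝ` is an amplitude of the rough-value
profile in Buchstab shape, i.e. `Φ_f(x,u)(log x)^k/x − B₀(x)·(u ω(u))^k → 0` for EVERY `u > 2`
(`ω = buchstabOmega`, Buchstab's function), then `B₀(x) → A := C(f)/∏ᵢ deg fᵢ`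
(`C(f) = batemanHornConst f`).

## The argument

Everything used is PROVED in the tree.

1. The calibration band (line `increment-anchoring`, lead 0):
   `IncrementAnchoring.sieveAnchor_of_parts` fed with `IncrementAnchoring.stub_sieveBand` (the
   two-sided fundamental lemma along `f`) and `IncrementAnchoring.stub_mertensAlongSystem`
   (Mertens along the system) gives `B = A·e^{−kγ} > 0` and, for every `ε > 0`, a depth `U₁(ε)`
   such that for every `U ≥ U₁(ε)`, eventually in `x`,
   `(1 − ε) B U^k ≤ Φ_f(x,U)(log x)^k/x ≤ (1 + ε) B U^k`.
2. `ω(v) → e^{−γ}` (`harman2007_buchstabOmega_tendsto_holds`), hence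
   `g(v) := B/ω(v)^k → B e^{kγ} = A` as `v → ∞`; and `ω(v) ≥ 1/2 > 0` for `v ≥ 1`
   (`half_le_buchstabOmega`).
3. Given `η > 0` put `ε = η/(4A + 2η + 1)` and pick ONE depth `v ≥ max(U₁(ε), 3)` with
   `|g(v) − A| < η/2`.  Eventually in `x`: the band at `U = v` and the hypothesis at `u = v` (with
   tolerance `ε B v^k`) give `|B₀(x) v^k ω(v)^k − B v^k| < 2ε B v^k`; cancelling `v^k > 0` and
   `ω(v)^k > 0` (`AmplitudeAnchor.abs_sub_div_lt`), `|B₀(x) − g(v)| < 2ε g(v) < η/2` (because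
   `g(v) < A + η/2` and `2ε(A + η/2) ≤ η/2` by the choice of `ε`), so `|B₀(x) − A| < η`.

The edge `k = 0` (`Φ = x`, `B₀ → 1 = C(∅)/1`) needs no special treatment.  No definition and no
new fact is introduced.
-/

noncomputable section

open Filter Finset Polynomial
open scoped BigOperators Topology ArithmeticFunction.Omega
open Literature.NumberTheory.Sieve

namespace Summit.Parity.BatemanHorn.Cruxes.RoughValueLaw.OmegaClassShapeSplit

namespace AmplitudeAnchor

/-- **The squeeze at one depth (pure arithmetic).**  If `P` lies in the band
`[(1 − e) b t, (1 + e) b t]` and `|P − Q·(t·W)| < e b t` with `t, W > 0`, then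
`|Q − b/W| < 2e·(b/W)`: indeed `|Q t W − b t| < 2 e b t`, cancel `t`, then divide by `W`.
(Used with `P = Φ_f(x,v)(log x)^k/x`, `Q = B₀(x)`, `t = v^k`, `W = ω(v)^k`, `b = B`.) [folklore] -/
theorem abs_sub_div_lt {P Q b W t e : ℝ} (ht : 0 < t) (hW : 0 < W)
    (hlo : (1 - e) * (b * t) ≤ P) (hhi : P ≤ (1 + e) * (b * t))
    (hQ : |P - Q * (t * W)| < e * (b * t)) :
    |Q - b / W| < 2 * e * (b / W) := by
  have h1 : |Q * (t * W) - b * t| < 2 * e * b * t := by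
    rw [abs_sub_lt_iff] at hQ ⊢
    obtain ⟨hQ1, hQ2⟩ := hQ
    constructor <;> linarith
  have h2 : |Q * W - b| * t < 2 * e * b * t := by
    calc |Q * W - b| * t = |(Q * W - b) * t| := by rw [abs_mul, abs_of_pos ht]
      _ = |Q * (t * W) - b * t| := by congr 1; ring
      _ < 2 * e * b * t := h1
  have h3 : |Q * W - b| < 2 * e * b := lt_of_mul_lt_mul_right h2 ht.le
  have h4 : |Q - b / W| * W < 2 * e * (b / W) * W := by
    calc |Q - b / W| * W = |(Q - b / W) * W| := by rw [abs_mul, abs_of_pos hW]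
      _ = |Q * W - b| := by rw [sub_mul, div_mul_cancel₀ b hW.ne']
      _ < 2 * e * b := h3
      _ = 2 * e * (b / W) * W := by rw [mul_assoc (2 * e) (b / W) W, div_mul_cancel₀ b hW.ne']
  exact lt_of_mul_lt_mul_right h4 hW.le

/-- **The tolerance.**  With `ε = η/(4A + 2η + 1)` (encoded as `ε (4A + 2η + 1) = η`), `ε > 0`
and `g < A + η/2`: `2 ε g < η/2`. [folklore] -/
theorem two_mul_mul_lt_half {ε η A g : ℝ} (hε : 0 < ε) (hεeq : ε * (4 * A + 2 * η + 1) = η)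
    (hg : g < A + η / 2) : 2 * ε * g < η / 2 := by
  have h1 : 2 * ε * g < 2 * ε * (A + η / 2) := mul_lt_mul_of_pos_left hg (by linarith)
  linarith

end AmplitudeAnchor

/-- **stub_amplitudeAnchor** (registered stub of the skeleton
`Cruxes/RoughValueLaw/Lines/omega-class-shape-split.lean`, crux stmt-Parity-11390).
**Anchoring of a Buchstab-shaped amplitude.**  For a Bateman–Horn system `f` of `k` polynomials: if
`B₀ : ℕ → ℝ` satisfies `Φ_f(x,u)(log x)^k/x − B₀(x)(u ω(u))^k → 0` for every `u > 2`
(`Φ_f(x,u)` the jointly `x^{deg fᵢ/u}`-rough count, `ω = buchstabOmega`), then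
`B₀(x) → batemanHornConst f / ∏ᵢ deg fᵢ`.  Proof: the calibration band
`IncrementAnchoring.sieveAnchor_of_parts stub_sieveBand stub_mertensAlongSystem` at ONE large depth
`v`, the hypothesis at `u = v`, `ω(v) → e^{−γ}` (`harman2007_buchstabOmega_tendsto_holds`) and
`ω ≥ 1/2` (`half_le_buchstabOmega`); see the module docstring. [folklore] -/
theorem stub_amplitudeAnchor :
    ∀ (k : ℕ) (f : Fin k → ℤ[X]), IsBatemanHornSystem f → ∀ B₀ : ℕ → ℝ, (∀ u : ℝ, 2 < u →
      Tendsto (fun x : ℕ => (((Icc 1 x).filter (fun n : ℕ => ∀ i, 0 < (f i).eval (n : ℤ) ∧ ∀ p ∈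
      range ⌈(x : ℝ) ^ (((f i).natDegree : ℝ) / u)⌉₊, p.Prime → ¬ ((p : ℤ) ∣ (f i).eval (n :
      ℤ)))).card : ℝ) * Real.log x ^ k / x - B₀ x * (u * buchstabOmega u) ^ k) atTop (𝓝 0)) →
      Tendsto B₀ atTop (𝓝 (batemanHornConst f / (∏ i, ((f i).natDegree : ℝ)))) := by
  intro k f hf B₀ hB₀
  obtain ⟨hBpos, hband⟩ :=
    IncrementAnchoring.sieveAnchor_of_parts IncrementAnchoring.stub_sieveBand
      IncrementAnchoring.stub_mertensAlongSystem k f hf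
  set A : ℝ := batemanHornConst f / (∏ i, ((f i).natDegree : ℝ)) with hAdef
  set B : ℝ := A * Real.exp (-((k : ℝ) * Real.eulerMascheroniConstant)) with hBdef
  have hC : 0 < batemanHornConst f := (IsBatemanHornSystem.hasBatemanHornConst_holds hf).2
  have hD : 0 < ∏ i, ((f i).natDegree : ℝ) :=
    Finset.prod_pos fun i _ => by exact_mod_cast hf.natDegree_pos i
  have hA : 0 < A := div_pos hC hD
  -- `ω → e^{-γ}`, hence `B / ω(w)^k → B e^{kγ} = A`
  have hωlim : Tendsto buchstabOmega atTop (𝓝 (Real.exp (-Real.eulerMascheroniConstant))) :=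
    harman2007_buchstabOmega_tendsto_holds
  have hg : Tendsto (fun w : ℝ => B / buchstabOmega w ^ k) atTop (𝓝 A) := by
    have h1 : Tendsto (fun w : ℝ => B / buchstabOmega w ^ k) atTop
        (𝓝 (B / Real.exp (-Real.eulerMascheroniConstant) ^ k)) :=
      tendsto_const_nhds.div (hωlim.pow k) (pow_ne_zero k (Real.exp_pos _).ne')
    have h2 : B / Real.exp (-Real.eulerMascheroniConstant) ^ k = A := by
      rw [hBdef, ← Real.exp_nat_mul, mul_neg, mul_div_assoc, div_self (Real.exp_pos _).ne',
        mul_one]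
    rw [h2] at h1
    exact h1
  rw [Metric.tendsto_nhds]
  intro η hη
  -- the tolerance of the band
  have hden : 0 < 4 * A + 2 * η + 1 := by linarith
  set ε : ℝ := η / (4 * A + 2 * η + 1) with hεdef
  have hε : 0 < ε := div_pos hη hden
  have hεeq : ε * (4 * A + 2 * η + 1) = η := div_mul_cancel₀ η hden.ne'
  obtain ⟨U₁, hU₁⟩ := hband ε hε
  -- ONE depth `v`: `v ≥ U₁`, `v ≥ 3`, `|B/ω(v)^k − A| < η/2`
  obtain ⟨v, hvU, hv3, hgv⟩ := ((eventually_ge_atTop U₁).and ((eventually_ge_atTop (3 : ℝ)).and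
    ((Metric.tendsto_nhds.mp hg) (η / 2) (half_pos hη)))).exists
  have hωv : 0 < buchstabOmega v :=
    lt_of_lt_of_le one_half_pos (half_le_buchstabOmega (by linarith))
  have hW : 0 < buchstabOmega v ^ k := pow_pos hωv k
  have hvk : 0 < v ^ k := pow_pos (by linarith) k
  have hgv' : |B / buchstabOmega v ^ k - A| < η / 2 := by rwa [Real.dist_eq] at hgv
  have hsmall : 2 * ε * (B / buchstabOmega v ^ k) < η / 2 :=
    AmplitudeAnchor.two_mul_mul_lt_half hε hεeq (by linarith [(abs_lt.mp hgv').2])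
  -- eventually in `x`: the band at depth `v` and the hypothesis at `u = v`
  have h1 := hU₁ v hvU
  have h2 : ∀ᶠ x : ℕ in atTop, |(((Icc 1 x).filter (fun n : ℕ => ∀ i, 0 < (f i).eval (n : ℤ) ∧
      ∀ p ∈ range ⌈(x : ℝ) ^ (((f i).natDegree : ℝ) / v)⌉₊,
        p.Prime → ¬ ((p : ℤ) ∣ (f i).eval (n : ℤ)))).card : ℝ) * Real.log x ^ k / x -
      B₀ x * (v * buchstabOmega v) ^ k| < ε * (B * v ^ k) := by
    have hpos : 0 < ε * (B * v ^ k) := mul_pos hε (mul_pos hBpos hvk)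
    filter_upwards [(Metric.tendsto_nhds.mp (hB₀ v (by linarith))) _ hpos] with x hx
    rwa [Real.dist_eq, sub_zero] at hx
  filter_upwards [h1, h2] with x hx1 hx2
  rw [Real.dist_eq]
  rw [mul_pow] at hx2
  have h3 : |B₀ x - B / buchstabOmega v ^ k| < 2 * ε * (B / buchstabOmega v ^ k) :=
    AmplitudeAnchor.abs_sub_div_lt hvk hW hx1.1 hx1.2 hx2
  calc |B₀ x - A| ≤ |B₀ x - B / buchstabOmega v ^ k| + |B / buchstabOmega v ^ k - A| :=
        abs_sub_le _ _ _
    _ < 2 * ε * (B / buchstabOmega v ^ k) + η / 2 := add_lt_add h3 hgv'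
    _ ≤ η := by linarith [hsmall]

end Summit.Parity.BatemanHorn.Cruxes.RoughValueLaw.OmegaClassShapeSplit

end
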